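import Summits.AtomisticToContinuum.FouriersLaw.Theorems.EmbeddedDrudeMourreAbelThermodynamicLimitFixedTimeOffsetMatchingSeveredLimit
import Literature.MathematicalPhysics.KineticTheory.InfiniteChainCovarianceMixingBox

/-!
# Stub (B′|E1,M1sev) `stub_uniformFixedTimeOffsetMatchingOfEngines`, part 3: two-level truncation and bookkeeping tools
(crux `LatticeLandauDamping.AbelThermodynamicLimit`, item stmt-AtomisticToContinuum-14013, line
`series-law-at-every-laplace-frequency` (SketchIdeator2); `--supports` helper file, closes nothing)

Generic tools of the coupling (B′) ← (E1) + (M1sev):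

* §1 the TWO-LEVEL truncation inequality for a product `u · w` under a finite measure,
  `|∫ u w − ∫ h_A(u) h_B(w)| ≤ (∫u⁴)^{1/2} (∫w²)^{1/2}/A + A (∫w²)/B` (`h_C` the clamp at level `C`): only the FOURTH moment of
  the static factor `u` (a bond current, `N`-uniformly in `L⁴`) and the SECOND moment of the dynamical factor `w` (the
  severed-window current of (M1sev), only known in `L²`) are used — the one-level inequality of the sibling line needs
  fourth moments of both factors;
* §2 the choice of the truncation levels and of the `(M1sev)` tolerance;
* the registered closed form `offsetMatching_twoLevelTruncation`.

All statements proved; `[folklore]`. No definitions.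
-/

noncomputable section

namespace Summit.AtomisticToContinuum.FouriersLaw.Theorems.AbelThermodynamicLimit.SeriesLawAtEveryLaplaceFrequency

open MeasureTheory Set Filter Topology Function
open Literature.MathematicalPhysics.KineticTheory Literature.MathematicalPhysics.KineticTheory.HeatConduction
open Literature.Analysis.FunctionSpaces (abs_max_neg_min_le)
open Summit.AtomisticToContinuum.FouriersLaw.Theorems.AbelThermodynamicLimit.LoomisCompactHorizonWitness
  (abs_sub_clamp_le_sq_div continuous_clamp)

namespace OffsetMatching

/-! ### §1 Two-level truncation of a product -/

section Truncation

variable {Ω : Type*} [MeasurableSpace Ω] (ρ : Measure Ω)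

/-- **Cauchy–Schwarz for `∫ u² |w|`**: `∫ u²|w| ≤ (∫ u⁴)^{1/2} (∫ w²)^{1/2}`, with `u²|w| ∈ L¹` (from `u⁴, w² ∈ L¹`).
[folklore] -/
theorem integral_sq_mul_abs_le {u w : Ω → ℝ} (hu : Measurable u) (hw : Measurable w)
    (hu4 : Integrable (fun q => u q ^ 4) ρ) (hw2 : Integrable (fun q => w q ^ 2) ρ) :
    Integrable (fun q => u q ^ 2 * |w q|) ρ ∧
      ∫ q, u q ^ 2 * |w q| ∂ρ ≤ Real.sqrt (∫ q, u q ^ 4 ∂ρ) * Real.sqrt (∫ q, w q ^ 2 ∂ρ) := by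
  have hf : MemLp (fun q => u q ^ 2) 2 ρ := by
    refine (memLp_two_iff_integrable_sq (hu.pow_const 2).aestronglyMeasurable).2 ?_
    refine hu4.congr (Eventually.of_forall fun q => ?_)
    ring
  have hg : MemLp (fun q => |w q|) 2 ρ := by
    refine (memLp_two_iff_integrable_sq hw.abs.aestronglyMeasurable).2 ?_
    exact hw2.congr (Eventually.of_forall fun q => (sq_abs (w q)).symm)
  have hint : Integrable (fun q => u q ^ 2 * |w q|) ρ := hf.integrable_mul hg
  refine ⟨hint, ?_⟩
  have h := abs_integral_mul_le_sqrt_integral_sq_mul hf hg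
  have e1 : ∫ q, (u q ^ 2) ^ 2 ∂ρ = ∫ q, u q ^ 4 ∂ρ := integral_congr_ae (Eventually.of_forall fun q => by ring)
  have e2 : ∫ q, |w q| ^ 2 ∂ρ = ∫ q, w q ^ 2 ∂ρ := integral_congr_ae (Eventually.of_forall fun q => sq_abs (w q))
  rw [e1, e2] at h
  exact (le_abs_self _).trans h

/-- **The two-level truncation inequality.** On a finite measure space, for measurable `u, w` with `u w, u⁴, w² ∈ L¹`
and clamp levels `A, B > 0`: `|∫ u w − ∫ h_A(u) h_B(w)| ≤ (∫u⁴)^{1/2}(∫w²)^{1/2}/A + A(∫w²)/B` (pointwise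
`u w − h_A(u) h_B(w) = (u − h_A u) w + h_A(u)(w − h_B w)`, `|r − h_C(r)| ≤ r²/C`, `|h_A| ≤ A`). [folklore] -/
theorem abs_integral_mul_sub_integral_clamp_two_le [IsFiniteMeasure ρ] {u w : Ω → ℝ} (hu : Measurable u)
    (hw : Measurable w) (huw : Integrable (fun q => u q * w q) ρ) (hu4 : Integrable (fun q => u q ^ 4) ρ)
    (hw2 : Integrable (fun q => w q ^ 2) ρ) {A B : ℝ} (hA : 0 < A) (hB : 0 < B) :
    |(∫ q, u q * w q ∂ρ) - ∫ q, max (-A) (min A (u q)) * max (-B) (min B (w q)) ∂ρ| ≤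
      Real.sqrt (∫ q, u q ^ 4 ∂ρ) * Real.sqrt (∫ q, w q ^ 2 ∂ρ) / A + A * (∫ q, w q ^ 2 ∂ρ) / B := by
  obtain ⟨hint, hcs⟩ := integral_sq_mul_abs_le ρ hu hw hu4 hw2
  have hhm : Measurable fun q => max (-A) (min A (u q)) * max (-B) (min B (w q)) :=
    ((continuous_clamp A).measurable.comp hu).mul ((continuous_clamp B).measurable.comp hw)
  have hhi : Integrable (fun q => max (-A) (min A (u q)) * max (-B) (min B (w q))) ρ := by
    refine (integrable_const (A * B)).mono' hhm.aestronglyMeasurable (Eventually.of_forall fun q => ?_)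
    rw [Real.norm_eq_abs, abs_mul]
    exact mul_le_mul (abs_max_neg_min_le hA.le _) (abs_max_neg_min_le hB.le _) (abs_nonneg _) hA.le
  have hpt : ∀ q, |u q * w q - max (-A) (min A (u q)) * max (-B) (min B (w q))| ≤
      u q ^ 2 * |w q| / A + A * w q ^ 2 / B := by
    intro q
    set a := u q with ha
    set b := w q with hb
    set ka := max (-A) (min A a) with hka
    set kb := max (-B) (min B b) with hkb
    have h1 : |a - ka| ≤ a ^ 2 / A := abs_sub_clamp_le_sq_div hA a
    have h2 : |b - kb| ≤ b ^ 2 / B := abs_sub_clamp_le_sq_div hB b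
    have h3 : |ka| ≤ A := abs_max_neg_min_le hA.le a
    have e : a * b - ka * kb = (a - ka) * b + ka * (b - kb) := by ring
    calc |a * b - ka * kb| = |(a - ka) * b + ka * (b - kb)| := by rw [e]
      _ ≤ |(a - ka) * b| + |ka * (b - kb)| := abs_add_le _ _
      _ = |a - ka| * |b| + |ka| * |b - kb| := by rw [abs_mul, abs_mul]
      _ ≤ a ^ 2 / A * |b| + A * (b ^ 2 / B) := by
          gcongr
      _ = a ^ 2 * |b| / A + A * b ^ 2 / B := by ring
  have hmaj : Integrable (fun q => u q ^ 2 * |w q| / A + A * w q ^ 2 / B) ρ :=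
    (hint.div_const A).add ((hw2.const_mul A).div_const B)
  rw [← integral_sub huw hhi]
  calc |∫ q, (u q * w q - max (-A) (min A (u q)) * max (-B) (min B (w q))) ∂ρ|
      ≤ ∫ q, |u q * w q - max (-A) (min A (u q)) * max (-B) (min B (w q))| ∂ρ := abs_integral_le_integral_abs
    _ ≤ ∫ q, (u q ^ 2 * |w q| / A + A * w q ^ 2 / B) ∂ρ := integral_mono (huw.sub hhi).abs hmaj hpt
    _ = (∫ q, u q ^ 2 * |w q| ∂ρ) / A + A * (∫ q, w q ^ 2 ∂ρ) / B := by
        rw [integral_add (hint.div_const A) ((hw2.const_mul A).div_const B), integral_div, integral_div,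
          integral_const_mul]
    _ ≤ Real.sqrt (∫ q, u q ^ 4 ∂ρ) * Real.sqrt (∫ q, w q ^ 2 ∂ρ) / A + A * (∫ q, w q ^ 2 ∂ρ) / B := by
        gcongr

end Truncation

/-! ### §2 The choice of the tolerances -/

/-- **The truncation levels.** Given the moment bounds there are `A, B > 0` making both two-level truncation errors
`≤ ε/8`. [folklore] -/
theorem exists_truncation_levels {ε c₂ m₂ : ℝ} (c₄ m₄ : ℝ) (hε : 0 < ε) (hc₂ : 0 ≤ c₂) (hm₂ : 0 ≤ m₂) :
    ∃ A B : ℝ, 0 < A ∧ 0 < B ∧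
      Real.sqrt c₄ * Real.sqrt c₂ / A + A * c₂ / B ≤ ε / 8 ∧
      Real.sqrt m₄ * Real.sqrt m₂ / A + A * m₂ / B ≤ ε / 8 := by
  set S : ℝ := Real.sqrt c₄ * Real.sqrt c₂ + Real.sqrt m₄ * Real.sqrt m₂ with hS
  have hS0 : 0 ≤ S := by rw [hS]; positivity
  set A : ℝ := 16 * S / ε + 1 with hA
  have hA0 : 0 < A := by rw [hA]; positivity
  set B : ℝ := 16 * A * (c₂ + m₂) / ε + 1 with hB
  have hB0 : 0 < B := by rw [hB]; positivity
  have hεA : ε / 16 * A = S + ε / 16 := by rw [hA]; field_simp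
  have hεB : ε / 16 * B = A * (c₂ + m₂) + ε / 16 := by rw [hB]; field_simp
  have h1 : Real.sqrt c₄ * Real.sqrt c₂ / A ≤ ε / 16 := by
    rw [div_le_iff₀ hA0, hεA, hS]; nlinarith [Real.sqrt_nonneg m₄, Real.sqrt_nonneg m₂, hε]
  have h2 : Real.sqrt m₄ * Real.sqrt m₂ / A ≤ ε / 16 := by
    rw [div_le_iff₀ hA0, hεA, hS]; nlinarith [Real.sqrt_nonneg c₄, Real.sqrt_nonneg c₂, hε]
  have h3 : A * c₂ / B ≤ ε / 16 := by
    rw [div_le_iff₀ hB0, hεB]; nlinarith [hA0.le]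
  have h4 : A * m₂ / B ≤ ε / 16 := by
    rw [div_le_iff₀ hB0, hεB]; nlinarith [hA0.le]
  exact ⟨A, B, hA0, hB0, by linarith, by linarith⟩

/-- **The (M1sev) tolerance.** `ε_A = min(1, (ε/8)²/(C₂+1))` has `√C₂ √ε_A ≤ ε/8`. [folklore] -/
theorem sqrt_mul_sqrt_tolerance_le {C ε : ℝ} (hC : 0 ≤ C) (hε : 0 < ε) :
    0 < min 1 ((ε / 8) ^ 2 / (C + 1)) ∧ min 1 ((ε / 8) ^ 2 / (C + 1)) ≤ 1 ∧
      Real.sqrt C * Real.sqrt (min 1 ((ε / 8) ^ 2 / (C + 1))) ≤ ε / 8 := by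
  refine ⟨lt_min one_pos (by positivity), min_le_left _ _, ?_⟩
  rw [← Real.sqrt_mul hC]
  calc Real.sqrt (C * min 1 ((ε / 8) ^ 2 / (C + 1))) ≤ Real.sqrt ((ε / 8) ^ 2) := by
        refine Real.sqrt_le_sqrt ?_
        calc C * min 1 ((ε / 8) ^ 2 / (C + 1)) ≤ C * ((ε / 8) ^ 2 / (C + 1)) :=
              mul_le_mul_of_nonneg_left (min_le_right _ _) hC
          _ ≤ (ε / 8) ^ 2 := by
              rw [← mul_div_assoc, div_le_iff₀ (by positivity)]
              nlinarith [sq_nonneg (ε / 8)]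
    _ = ε / 8 := Real.sqrt_sq (by positivity)

end OffsetMatching

open OffsetMatching in
/-- **Registered helper `offsetMatching_twoLevelTruncation`** (stub (B′|E1,M1sev) of line `series-law-at-every-laplace-frequency`):
the two-level truncation scheme of the coupling in closed form — (i) the truncation inequality
`|∫ u w − ∫ h_A(u) h_B(w)| ≤ (∫u⁴)^{1/2}(∫w²)^{1/2}/A + A(∫w²)/B` on any finite measure space, (ii) the existence of levels
`A, B` making two such errors `≤ ε/8`, (iii) the `(M1sev)` tolerance `ε_A` with `√C₂ √ε_A ≤ ε/8`. [folklore] -/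
theorem offsetMatching_twoLevelTruncation :
    (∀ (Ω : Type) [MeasurableSpace Ω] (ρ : MeasureTheory.Measure Ω) [MeasureTheory.IsFiniteMeasure ρ] (u w : Ω → ℝ),
      Measurable u → Measurable w → MeasureTheory.Integrable (fun q => u q * w q) ρ →
      MeasureTheory.Integrable (fun q => u q ^ 4) ρ → MeasureTheory.Integrable (fun q => w q ^ 2) ρ →
      ∀ A B : ℝ, 0 < A → 0 < B →
        |(∫ q, u q * w q ∂ρ) - ∫ q, max (-A) (min A (u q)) * max (-B) (min B (w q)) ∂ρ| ≤
          Real.sqrt (∫ q, u q ^ 4 ∂ρ) * Real.sqrt (∫ q, w q ^ 2 ∂ρ) / A + A * (∫ q, w q ^ 2 ∂ρ) / B) ∧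
    (∀ ε c₂ m₂ c₄ m₄ : ℝ, 0 < ε → 0 ≤ c₂ → 0 ≤ m₂ → ∃ A B : ℝ, 0 < A ∧ 0 < B ∧
      Real.sqrt c₄ * Real.sqrt c₂ / A + A * c₂ / B ≤ ε / 8 ∧
      Real.sqrt m₄ * Real.sqrt m₂ / A + A * m₂ / B ≤ ε / 8) ∧
    (∀ C ε : ℝ, 0 ≤ C → 0 < ε →
      0 < min 1 ((ε / 8) ^ 2 / (C + 1)) ∧ min 1 ((ε / 8) ^ 2 / (C + 1)) ≤ 1 ∧
        Real.sqrt C * Real.sqrt (min 1 ((ε / 8) ^ 2 / (C + 1))) ≤ ε / 8) :=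
  ⟨fun _ _ ρ _ _ _ hu hw huw hu4 hw2 _ _ hA hB =>
      abs_integral_mul_sub_integral_clamp_two_le ρ hu hw huw hu4 hw2 hA hB,
    fun _ _ _ c₄ m₄ hε hc₂ hm₂ => exists_truncation_levels c₄ m₄ hε hc₂ hm₂,
    fun _ _ hC hε => sqrt_mul_sqrt_tolerance_le hC hε⟩



end Summit.AtomisticToContinuum.FouriersLaw.Theorems.AbelThermodynamicLimit.SeriesLawAtEveryLaplaceFrequency

end
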